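import Summits.Langlands.Langlands.Theses.FifteenLocusEisenstein
import HarnessLib

/-!
# Line `leaves_FifteenLocusEisenstein` — the BC2-REDIRECT skeleton of crux stmt-Langlands-16058
`Summit.Langlands.Langlands.Theses.FifteenLocusEisenstein.SectorComplement` (crux-strategist
planner-cstrat-stmt-Langlands-16058-r1-0, 2026-08-17; SUPERSEDES `Lines/birth_FifteenLocusEisenstein.lean` as the item's
registered skeleton — that birth file composes through the pre-re-type theorem
`IrreducibleOffSector.langlands_of_reciprocityUpToIrreducibility_text_of_JS` (`∃ Rec → Langlands`), which no longer
elaborates against the re-typed summit `∀ F, Nonempty (ReciprocityData F) ∧ ∀ 𝓡 …` (p141787, on disk 2026-08-17T04:35Z)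
and survives on the farm only as a stale olean.)

File name: the crux directory `Cruxes/SectorComplement/` is SHARED by the homonymous complement-of-the-sector cruxes of
several routes (12923, 14623, 12840, 16058, 18275, 18745, …); everything here is about stmt-Langlands-16058, hence the
`_FifteenLocusEisenstein` suffix and the namespace `…Cruxes.SectorComplement.LeavesFifteenLocusEisenstein`.

THE LINE.  `SectorComplement := Target → _root_.Langlands` (Target = point-count modularity of every non-CM integral
elliptic curve over every imaginary quadratic field).  Five stubs = the five CHILDREN of the split filed by this seat
(texts verbatim; W⁺ and U are the existing items stmt-Langlands-17415 / 17844):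

* `stub_reciprocityDataNonempty`  N    — reciprocity data exist (Harris–Taylor `rec_v`, Henniart-normalised against the pinned
                                          local Artin maps): the summit's non-vacuity conjunct [support, literature debt];
* `stub_satakeAvatarExistence`    W⁺   — irreducible Satake avatars exist for L-algebraic cuspidal `π` (BG 3.2.2 weak +
                                          Ramakrishnan) [crux, open; = stmt-Langlands-17415];
* `stub_weakAutomorphyOffTateFrames` B⁻ — Fontaine–Mazur–Langlands a.e. OFF the Tate-frame sector [crux, open];
* `stub_satakeAvatarCompatibility` LGC∀ — Taylor Conj. 7 for Satake pairs and every `𝓡`: de Rham above `ℓ` + local–global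
                                          compatibility at every finite place [crux, open];
* `stub_avatarConjugacy`           U    — uniqueness of the irreducible avatar up to conjugacy [support, provable now;
                                          = stmt-Langlands-17844].

Composition `SectorComplement_of : N → W⁺ → B⁻ → LGC∀ → U → SectorComplement` (kernel-checked, sorry-free, axioms propext /
Classical.choice / Quot.sound): the TARGET is consumed in direction (B) — an irreducible geometric `ρ` in the Tate-frame
sector gets its `π` from Target by Vieta on the 2-entry Satake parameter (`arithFrobPolyOfSatake ι (N w) 1 α = X² - a_w X + N w`),
off the sector from B⁻; then LGC∀ at the given `𝓡`; direction (A) = W⁺ + LGC∀ + U; non-vacuity = N.  The same proof on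
texts, importing `Summits.Langlands.Statement` only, is `Lines/split16058_Glue.lean` (the file a prover lands for the glue item).

Disproof used: none exists for THIS item (the shared `Disproof.lean` has parts for 18275 / 18745 only); its L3 costume test
("some stub restates the summit up to the sector — check `stub → C` by `fun h _ => …`") is honoured: probes stub → C and
stub → Langlands FAILED 40/40 (BC report).  Dead lines: the birth skeleton above (stale seam), superseded here.
-/

noncomputable section

set_option linter.dupNamespace false

open scoped NumberField Classical Polynomial
open Filter IsDedekindDomain Polynomial
open Literature.NumberTheory.Automorphic Literature.NumberTheory.GaloisRepresentations
open Summit.Langlands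
open Summit.Langlands.Langlands.Theses.FifteenLocusEisenstein

namespace Summit.Langlands.Langlands.Cruxes.SectorComplement.LeavesFifteenLocusEisenstein

/-- The crux, for the record: `SectorComplement ↔ (Target-text → Langlands)`. -/
theorem sectorComplement_iff : SectorComplement ↔ ((∀ (F : Type) [Field F] [NumberField F], NumberField.IsTotallyComplex F → Module.finrank ℚ F = 2 → ∀ (E : WeierstrassCurve (NumberField.RingOfIntegers F)), E.Δ ≠ 0 → ¬ (E.baseChange F).HasCM → ∀ (hcpt : Literature.NumberTheory.Automorphic.isCompact_glFiniteIntegralLevel 2 F), ∃ π : Literature.NumberTheory.Automorphic.CuspidalAutomorphicRepData 2 F hcpt, π.1.IsLAlgebraic ∧ ∀ᶠ w : IsDedekindDomain.HeightOneSpectrum (NumberField.RingOfIntegers F) in Filter.cofinite, ∃ α : Multiset ℂ, π.1.HasSatakeParamAt w α ∧ (α.map fun a => a⁻¹).sum = (Literature.NumberTheory.Automorphic.frobTraceAt E w : ℂ) ∧ (α.map fun a => a⁻¹).prod = (w.residueCard : ℂ)) → _root_.Langlands) := Iff.rfl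

/-! ## 1. The five stubs (the ONLY sorries of this file) -/

/-- **stub N — reciprocity data exist** (Harris–Taylor 2001 Thm. A / Henniart 2000 at every completion of every number
field, normalised against THE local Artin map `canonicalArtin (K_v)` and with canonically normalised `ε`-systems — the
fields `llc`, `llc_isCanonical`, `llc_eps_isCanonical` of `ReciprocityData`).  A theorem in print; in the tree the T0 debt
`LocalLanglandsDatum.nonempty` + the Lubin–Tate pin.  Why it might fail: only if `LocalLanglandsDatum (K_v)` were
unsatisfiable as typed (then the summit is false too). [cite: HarrisTaylorAMS2001, Thm. A] -/
theorem stub_reciprocityDataNonempty : ∀ (K : Type) [Field K] [NumberField K], Nonempty (ReciprocityData K) := by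
  sorry

/-- **stub W⁺ — irreducible Satake avatars exist** (VERBATIM item stmt-Langlands-17415 `SatakeAvatarExistence`):
Buzzard–Gee Conj. 3.2.2 (weak form) + Ramakrishnan's "cuspidal ⇒ irreducible".  Known: regular algebraic `π` over CM /
totally real `K` give the avatar (HLTT 2016, Scholze 2015), irreducible for `n ≤ 3` / polarised density-one cases; open for
irregular `π` and general `K`. [cite: BuzzardGeeLMS2014, Conj. 3.2.2] -/
theorem stub_satakeAvatarExistence : ∀ (K : Type) [Field K] [NumberField K] (n : ℕ) (hcpt : Literature.NumberTheory.Automorphic.isCompact_glFiniteIntegralLevel n K), 0 < n → ∀ (π : Literature.NumberTheory.Automorphic.CuspidalAutomorphicRepData n K hcpt), π.1.IsLAlgebraic → ∀ (ℓ : ℕ) [Fact ℓ.Prime] (ι : PadicAlgCl ℓ ≃+* ℂ), ∃ ρ : Literature.NumberTheory.GaloisRepresentations.FramedGaloisRep K (PadicAlgCl ℓ) n, ρ.toGaloisRep.IsIrreducible ∧ ∀ᶠ v : IsDedekindDomain.HeightOneSpectrum (NumberField.RingOfIntegers K) in cofinite, SatakeFrobCompatibleAt ι π.1 ρ v := by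
  sorry

/-- **stub B⁻ — Fontaine–Mazur–Langlands a.e., OFF the Tate-frame sector** (item stmt-Langlands-17414 with the route's
sector excised: irreducible geometric `ρ : Γ_K → GL_n(ℚ̄_ℓ)` that are NOT a.e. Tate frames of a non-CM integral elliptic
curve over an imaginary quadratic `K`, `n = 2`).  Open (automorphy lifting exists only in regular, residually-large-image,
CM/totally-real regimes). [cite: FontaineMazurGeometric1995, Conj. 1] [cite: BuzzardGeeLMS2014, Conj. 3.2.2] -/
theorem stub_weakAutomorphyOffTateFrames : ∀ (K : Type) [Field K] [NumberField K] (n : ℕ) (hcpt : Literature.NumberTheory.Automorphic.isCompact_glFiniteIntegralLevel n K), 0 < n → ∀ (ℓ : ℕ) [Fact ℓ.Prime] (ι : PadicAlgCl ℓ ≃+* ℂ) (ρ : Literature.NumberTheory.GaloisRepresentations.FramedGaloisRep K (PadicAlgCl ℓ) n), ρ.toGaloisRep.IsIrreducible → ((∀ᶠ v : IsDedekindDomain.HeightOneSpectrum (NumberField.RingOfIntegers K) in cofinite, ρ.IsUnramifiedAt v) ∧ ∀ (v : IsDedekindDomain.HeightOneSpectrum (NumberField.RingOfIntegers K)) (hv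 : ((ℓ : ℕ) : NumberField.RingOfIntegers K) ∈ v.asIdeal), (Literature.NumberTheory.PAdicHodge.fontainePstAdicCompletion v ℓ hv).IsDeRhamFramed (ρ.toLocal v)) → ¬ (NumberField.IsTotallyComplex K ∧ Module.finrank ℚ K = 2 ∧ n = 2 ∧ ∃ E : WeierstrassCurve (NumberField.RingOfIntegers K), E.Δ ≠ 0 ∧ ¬ (E.baseChange K).HasCM ∧ ∀ᶠ w : IsDedekindDomain.HeightOneSpectrum (NumberField.RingOfIntegers K) in cofinite, ρ.IsUnramifiedAt w ∧ ρ.HasFrobCharpolyAt w (Polynomial.X ^ 2 - Polynomial.C ((Literature.NumberTheory.Automorphic.frobTraceAt E w : ℤ) : PadicAlgCl ℓ) * Polynomial.X + Polynomial.C ((w.residueCard : ℕ) : PadicAlgCl ℓ))) → ∃ π : Literature.NumberTheory.Automorphic.CuspidalAutomorphicRepData n K hcpt, π.1.IsLAlgebraic ∧ ∀ᶠ v : IsDedekindDomain.HeightOneSpectrum (NumberField.RingOfIntegers K) in cofinite, SatakeFrobCompatibleAt ι π.1 ρ v := by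
  sorry

/-- **stub LGC∀ — Taylor 2004 Conj. 7 for Satake pairs, every reciprocity datum**: an irreducible Satake avatar of an
L-algebraic cuspidal `π` is de Rham above `ℓ` (Fontaine's pinned datum) and locally–globally compatible with `π` at EVERY
finite place for EVERY Henniart-normalised `𝓡`.  Known for regular conjugate-self-dual `π` over CM fields (Harris–Taylor,
Taylor–Yoshida, Caraiani; Varma up to semisimplification for non-polarised regular); open otherwise.
[cite: TaylorGaloisRepresentations2004, Conj. 7] [cite: HarrisTaylorAMS2001, Thm. A] -/
theorem stub_satakeAvatarCompatibility : ∀ (K : Type) [Field K] [NumberField K] (n : ℕ) (hcpt : Literature.NumberTheory.Automorphic.isCompact_glFiniteIntegralLevel n K), 0 < n → ∀ (π : Literature.NumberTheory.Automorphic.CuspidalAutomorphicRepData n K hcpt), π.1.IsLAlgebraic → ∀ (ℓ : ℕ) [Fact ℓ.Prime] (ι : PadicAlgCl ℓ ≃+* ℂ) (ρ : Literature.NumberTheory.GaloisRepresentations.FramedGaloisRep K (PadicAlgCl ℓ) n), ρ.toGaloisRep.IsIrreducible → (∀ᶠ v : IsDedekindDomain.HeightOneSpectrum (NumberField.RingOfIntegers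 K) in Filter.cofinite, SatakeFrobCompatibleAt ι π.1 ρ v) → (∀ (v : IsDedekindDomain.HeightOneSpectrum (NumberField.RingOfIntegers K)) (hv : ((ℓ : ℕ) : NumberField.RingOfIntegers K) ∈ v.asIdeal), (Literature.NumberTheory.PAdicHodge.fontainePstAdicCompletion v ℓ hv).IsDeRhamFramed (ρ.toLocal v)) ∧ ∀ (𝓡 : ReciprocityData K) (v : IsDedekindDomain.HeightOneSpectrum (NumberField.RingOfIntegers K)), LocalGlobalCompatibleAt 𝓡 ι π.1 ρ v := by
  sorry

/-- **stub U — the irreducible avatar is unique up to conjugacy** (VERBATIM item stmt-Langlands-17844 `AvatarConjugacy`;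
Chebotarev + Brauer–Nesbitt, Deligne–Serre Lemme 3.2; provable now from
`ReciprocityUpToIrreducibility.isConjugate_of_satakeFrobCompatibleAt`, kept a stub/item for import-cone hygiene).
[cite: DeligneSerreASENS1974, Lemme 3.2] -/
theorem stub_avatarConjugacy : ∀ (K : Type) [Field K] [NumberField K] (n : ℕ) (hcpt : Literature.NumberTheory.Automorphic.isCompact_glFiniteIntegralLevel n K) (π : Literature.NumberTheory.Automorphic.CuspidalAutomorphicRepData n K hcpt) (ℓ : ℕ) [Fact ℓ.Prime] (ι : PadicAlgCl ℓ ≃+* ℂ) (ρ₀ ρ : Literature.NumberTheory.GaloisRepresentations.FramedGaloisRep K (PadicAlgCl ℓ) n), ρ₀.toGaloisRep.IsIrreducible → (∀ᶠ v : IsDedekindDomain.HeightOneSpectrum (NumberField.RingOfIntegers K) in Filter.cofinite, Summit.Langlands.SatakeFrobCompatibleAt ι π.1 ρ₀ v) → (∀ᶠ v : IsDedekindDomain.HeightOneSpectrum (NumberField.RingOfIntegers K) in Filter.cofinite, Summit.Langlands.SatakeFrobCompatibleAt ι π.1 ρ v) → Summit.Langlands.IsConjugate ρ₀ ρ := by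
  sorry

/-! ## 2. The seam -/

/-- Vieta for a 2-entry Satake parameter read through point counts. [folklore] -/
theorem arithFrobPolyOfSatake_one_of_card_two {ℓ : ℕ} [Fact ℓ.Prime] (ι : PadicAlgCl ℓ ≃+* ℂ) (q : ℕ)
    {α : Multiset ℂ} (hcard : Multiset.card α = 2) {a : ℤ}
    (hsum : (α.map fun x => x⁻¹).sum = (a : ℂ)) (hprod : (α.map fun x => x⁻¹).prod = (q : ℂ)) :
    arithFrobPolyOfSatake ι q 1 α =
      Polynomial.X ^ 2 - Polynomial.C ((a : ℤ) : PadicAlgCl ℓ) * Polynomial.X + Polynomial.C ((q : ℕ) : PadicAlgCl ℓ) := by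
  obtain ⟨x, y, rfl⟩ := Multiset.card_eq_two.mp hcard
  rw [arithFrobPolyOfSatake_one]
  simp only [Multiset.insert_eq_cons, Multiset.map_cons, Multiset.map_singleton, Multiset.sum_cons,
    Multiset.sum_singleton, Multiset.prod_cons, Multiset.prod_singleton] at hsum hprod ⊢
  have h1 : ι.symm x⁻¹ + ι.symm y⁻¹ = (a : PadicAlgCl ℓ) := by
    rw [← map_add, hsum, map_intCast]
  have h2 : ι.symm x⁻¹ * ι.symm y⁻¹ = (q : PadicAlgCl ℓ) := by
    rw [← map_mul, hprod, map_natCast]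
  rw [← h1, ← h2, Polynomial.C_add, Polynomial.C_mul]
  ring

/-! ## 3. The stub statements as named propositions (hypotheses of the composition, admissible by stub name)

Each `_Goal.stub_x` is `type_of% @stub_x`: literally the stub's statement, no text duplicated, no `sorry` inherited. -/

namespace _Goal

/-- The statement of `stub_reciprocityDataNonempty` (literally its type). [folklore] -/
def stub_reciprocityDataNonempty : Prop :=
  type_of% @Summit.Langlands.Langlands.Cruxes.SectorComplement.LeavesFifteenLocusEisenstein.stub_reciprocityDataNonempty

/-- The statement of `stub_satakeAvatarExistence` (literally its type). [folklore] -/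
def stub_satakeAvatarExistence : Prop :=
  type_of% @Summit.Langlands.Langlands.Cruxes.SectorComplement.LeavesFifteenLocusEisenstein.stub_satakeAvatarExistence

/-- The statement of `stub_weakAutomorphyOffTateFrames` (literally its type). [folklore] -/
def stub_weakAutomorphyOffTateFrames : Prop :=
  type_of% @Summit.Langlands.Langlands.Cruxes.SectorComplement.LeavesFifteenLocusEisenstein.stub_weakAutomorphyOffTateFrames

/-- The statement of `stub_satakeAvatarCompatibility` (literally its type). [folklore] -/
def stub_satakeAvatarCompatibility : Prop :=
  type_of% @Summit.Langlands.Langlands.Cruxes.SectorComplement.LeavesFifteenLocusEisenstein.stub_satakeAvatarCompatibility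

/-- The statement of `stub_avatarConjugacy` (literally its type). [folklore] -/
def stub_avatarConjugacy : Prop :=
  type_of% @Summit.Langlands.Langlands.Cruxes.SectorComplement.LeavesFifteenLocusEisenstein.stub_avatarConjugacy

end _Goal

/-! ## 4. The composition — concludes the crux BY NAME; hypotheses = the five stub statements by name -/

/-- **`SectorComplement` from N, W⁺, B⁻, LGC∀, U.**  The TARGET (antecedent of the crux) is consumed in direction (B): an
irreducible geometric `ρ` in the Tate-frame sector gets its `π` from Target (point counts ↦ `arithFrobPolyOfSatake` by Vieta,
`card α = 2`), off the sector from B⁻; then LGC∀ at the given `𝓡`.  Direction (A): W⁺ + LGC∀ (geometric: `𝓡.pst` IS Fontaine's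
datum, `rfl`) + U.  Non-vacuity: N.  [cite: BuzzardGeeLMS2014, Conj. 3.2.1 and Conj. 3.2.2] [cite: FontaineMazurGeometric1995, Conj. 1]
[cite: TaylorGaloisRepresentations2004, Conj. 7] [cite: DeligneSerreASENS1974, Lemme 3.2] -/
theorem SectorComplement_of (hN : _Goal.stub_reciprocityDataNonempty) (hW : _Goal.stub_satakeAvatarExistence)
    (hB : _Goal.stub_weakAutomorphyOffTateFrames) (hL : _Goal.stub_satakeAvatarCompatibility)
    (hU : _Goal.stub_avatarConjugacy) :
    Summit.Langlands.Langlands.Theses.FifteenLocusEisenstein.SectorComplement := by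
  dsimp only [_Goal.stub_reciprocityDataNonempty, _Goal.stub_satakeAvatarExistence, _Goal.stub_weakAutomorphyOffTateFrames,
    _Goal.stub_satakeAvatarCompatibility, _Goal.stub_avatarConjugacy] at hN hW hB hL hU
  intro hT F _ _
  refine ⟨hN F, fun 𝓡 n hn hcpt => ⟨?_, ?_⟩⟩
  · -- (A) automorphic → Galois
    intro π hπ ℓ _ ι
    obtain ⟨ρ, hirr, hρ⟩ := hW F n hcpt hn π hπ ℓ ι
    obtain ⟨hdR, hloc⟩ := hL F n hcpt hn π hπ ℓ ι ρ hirr hρ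
    have hgeo : IsGeometricFramed 𝓡 ρ :=
      ⟨hρ.mono fun v ⟨_, _, hur, _⟩ => hur, fun v hv => hdR v hv⟩
    exact ⟨ρ, hirr, hgeo, ⟨hρ, hloc 𝓡⟩, fun ρ' h' => hU F n hcpt π ℓ ι ρ ρ' hirr hρ h'.1⟩
  · -- (B) Galois → automorphic
    intro ℓ _ ι ρ hirr hgeo
    have hex : ∃ π : CuspidalAutomorphicRepData n F hcpt, π.1.IsLAlgebraic ∧
        ∀ᶠ v : HeightOneSpectrum (𝓞 F) in cofinite, SatakeFrobCompatibleAt ι π.1 ρ v := by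
      by_cases hsec : (NumberField.IsTotallyComplex F ∧ Module.finrank ℚ F = 2 ∧ n = 2 ∧
          ∃ E : WeierstrassCurve (𝓞 F), E.Δ ≠ 0 ∧ ¬ (E.baseChange F).HasCM ∧
            ∀ᶠ w : HeightOneSpectrum (𝓞 F) in cofinite, ρ.IsUnramifiedAt w ∧
              ρ.HasFrobCharpolyAt w (Polynomial.X ^ 2 -
                Polynomial.C ((frobTraceAt E w : ℤ) : PadicAlgCl ℓ) * Polynomial.X +
                  Polynomial.C ((w.residueCard : ℕ) : PadicAlgCl ℓ)))
      · -- on the Tate-frame sector: the route's TARGET, read through Vieta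
        obtain ⟨htc, hdeg, hn2, E, hΔ, hcm, hframe⟩ := hsec
        subst hn2
        obtain ⟨π, hLalg, hsat⟩ := hT F htc hdeg E hΔ hcm hcpt
        refine ⟨π, hLalg, ?_⟩
        filter_upwards [hsat, hframe] with w hw hw'
        obtain ⟨α, hα, hs, hp⟩ := hw
        obtain ⟨hur, hcp⟩ := hw'
        refine ⟨α, hα, hur, ?_⟩
        rw [arithFrobPolyOfSatake_one_of_card_two ι w.residueCard hα.card_eq hs hp]
        exact hcp
      · -- off the sector: B⁻
        exact hB F n hcpt hn ℓ ι ρ hirr hgeo hsec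
    obtain ⟨π, hLalg, hsat⟩ := hex
    obtain ⟨-, hloc⟩ := hL F n hcpt hn π hLalg ℓ ι ρ hirr hsat
    exact ⟨π, hLalg, hsat, hloc 𝓡⟩

/-- By-name sanity check (an `example`, not a declaration): the five stubs feed the composition as they stand. -/
example : Summit.Langlands.Langlands.Theses.FifteenLocusEisenstein.SectorComplement :=
  SectorComplement_of stub_reciprocityDataNonempty stub_satakeAvatarExistence stub_weakAutomorphyOffTateFrames
    stub_satakeAvatarCompatibility stub_avatarConjugacy

end Summit.Langlands.Langlands.Cruxes.SectorComplement.LeavesFifteenLocusEisenstein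

end
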